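import Literature.NumberTheory.Automorphic.HyperspecialUnitaryHeckeEigencharacterWeylInvariance
import Literature.NumberTheory.Automorphic.HeckeEigencharacterW0Invariance
import HarnessLib

/-!
# `λ_{χ ∘ π} = λ_χ` for the integrally normalised eigencharacters of `ℋ(U(σ, J₀), K₀)` over any commutative ring, every rank
# (Cartier 1979 §IV Thm. 4.1, Cor. 4.2)

Topic `NumberTheory/Automorphic`; namespace `Literature.NumberTheory.Automorphic.HermitianLattice.UnramifiedLocalConjDatum`
(lane `lit-hodgefound`, Track 2 foundations; seat `lit-hodgefound-p11`, generation 48, row g48-#14).  THEOREMS ONLY: no definition,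
no named fact, no instance, no notation.  The every-`π ∈ W` companion of `HeckeEigencharacterW0Invariance.heckeEigencharacter_comp_inv
_of_units_unitary` (g47-#7, the element `w₀ = -1` only): by the Weyl-group invariance of the coefficients of `𝒮_w(T)`
(`HyperspecialUnitarySatakeWeylInvariance`, g48-#5) and the abstract `IsIwasawaExponent.heckeEigencharacter_eq_of_forall_coeff`,
**for every commutative ring `R`, unit `u` with `(u : R) = q_F`, weight `w = u^{-⟨ν,·⟩}`, torus character `χ : ℤ^N → R` and
`π ∈ C_{S_N}(rev)`: `λ_{χ ∘ π_*} = λ_χ`** (`π_* μ = μ ∘ π`) — e.g. for mod-`ℓ` or `ℓ`-adic systems of Hecke eigenvalues.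

## What is formalised

* **`domCongr_funCongrLeft_satakeTransform_of_units_unitary`** (`π^*(𝒮_w T) = 𝒮_w T` in `R[ℤ^N]`),
  **`heckeEigencharacter_comp_perm_of_units_unitary`** (`λ_{χ ∘ π_*} = λ_χ`).
-/

noncomputable section

open scoped Valued WithZero Matrix MatrixGroups
open MonoidAlgebra Representation

namespace Literature.NumberTheory.Automorphic.HermitianLattice.UnramifiedLocalConjDatum

open Literature.NumberTheory.Automorphic Literature.NumberTheory.Automorphic.HermitianLattice

variable {K : Type*} [Field K] [Valued K ℤᵐ⁰] {σ : K →+* K} {ϖ : K} {N : ℕ} {R : Type*} [CommRing R]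

/-- **`π^*(𝒮_w T) = 𝒮_w T`**: the integrally normalised Satake transform is fixed by `domCongr` along `μ ↦ μ ∘ π` for every
`π ∈ C_{S_N}(rev)` (every `N`; `σ ≠ id`, finite residue field, `(u : R) = q_F`, `w = u^{-⟨ν,·⟩}`).
[cite: CartierCorvallis1979, §IV Thm. 4.1] [cite: Minguez2011, §4] -/
theorem domCongr_funCongrLeft_satakeTransform_of_units_unitary (hd : UnramifiedLocalConjDatum σ ϖ) [Finite 𝓀[K]]
    (hσ : ∃ x : K, σ x ≠ x) (u : Rˣ) (hu : (u : R) = Nat.sqrt (Nat.card 𝓀[K])) (w : Multiplicative (Fin N → ℤ) →* R)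
    (hw : ∀ e : Fin N → ℤ, w (Multiplicative.ofAdd e) = ((u ^ (-satakeTwistExp e) : Rˣ) : R))
    (T : heckeAlgebra R (unitaryGroupOfForm σ ((StdForm.antidiagonal N).over K)) (unitaryInt σ ((StdForm.antidiagonal N).over K)))
    {π : Equiv.Perm (Fin N)} (hπ : ∀ i, π (Fin.rev i) = Fin.rev (π i)) :
    AddMonoidAlgebra.domCongr R R (LinearEquiv.funCongrLeft ℤ ℤ π).toAddEquiv ((hd.isIwasawaExponent (N := N)).satakeTransform w T) =
      (hd.isIwasawaExponent (N := N)).satakeTransform w T := by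
  refine (domCongr_eq_self_iff_coeff _ _).2 fun μ => ?_
  rw [SymmLaurent.funCongrLeft_toAddEquiv_apply]
  exact hd.coeff_satakeTransform_comp_perm_of_units_unitary hσ u hu N w hw T π hπ μ

/-- **`λ_{χ ∘ π_*} = λ_χ` OVER ANY COMMUTATIVE RING, EVERY `N`**: the integrally normalised eigencharacters of `ℋ(U(σ, J₀^{(N)}), K₀; R)`
(weight `u^{-⟨ν,·⟩}`, `(u : R) = q_F`) do not change when the torus character `χ` is moved by the Weyl group (`π_* μ = μ ∘ π`,
`π ∈ C_{S_N}(rev)`). [cite: CartierCorvallis1979, §IV Thm. 4.1, Cor. 4.2] [cite: Minguez2011, §4] -/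
theorem heckeEigencharacter_comp_perm_of_units_unitary (hd : UnramifiedLocalConjDatum σ ϖ) [Finite 𝓀[K]]
    (hσ : ∃ x : K, σ x ≠ x) (u : Rˣ) (hu : (u : R) = Nat.sqrt (Nat.card 𝓀[K])) (w : Multiplicative (Fin N → ℤ) →* R)
    (hw : ∀ e : Fin N → ℤ, w (Multiplicative.ofAdd e) = ((u ^ (-satakeTwistExp e) : Rˣ) : R))
    (χ : Multiplicative (Fin N → ℤ) →* R) {π : Equiv.Perm (Fin N)} (hπ : ∀ i, π (Fin.rev i) = Fin.rev (π i)) :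
    (hd.isIwasawaExponent (N := N)).heckeEigencharacter w
        (χ.comp (AddMonoidHom.toMultiplicative (LinearEquiv.funCongrLeft ℤ ℤ π).toAddEquiv.toAddMonoidHom)) =
      (hd.isIwasawaExponent (N := N)).heckeEigencharacter w χ := by
  haveI := isHeckeTriple_unitaryInt_of_finite_residueField hd.vϖ σ ((StdForm.antidiagonal N).over K)
  refine (hd.isIwasawaExponent (N := N)).heckeEigencharacter_eq_of_forall_coeff w χ _ fun T μ => ?_
  rw [SymmLaurent.funCongrLeft_toAddEquiv_apply]
  exact hd.coeff_satakeTransform_comp_perm_of_units_unitary hσ u hu N w hw T π hπ μ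

end Literature.NumberTheory.Automorphic.HermitianLattice.UnramifiedLocalConjDatum

end
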